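import Mathlib
import HarnessLib
import Literature.Probability.Percolation.Percolation
import Literature.Probability.Percolation.ConditionalPositiveAssociation

/-!
# `NoHeavyLowerTail` (crux stmt-CriticalPhenomena-4575), antithetic vdBHK programme: the EXPLICIT FORM OF THE RAA ORDER (graph level)

Support file (seat `prim-ineq-gen-7` gen 44; `--supports stmt-CriticalPhenomena-4575`).  No `sorry`, no definitions.
Memo: run/shared/lean/prim/prim-ineq-gen-7/FINDING-MULTISINK-g44.md §0′.

SETTING (FINDING-RAA-g20 §1, in the language of `Literature.Probability.Percolation`).  An edge set `E ⊆ Sym2 V` without loops; a 2-colouring of `E` is a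
red set `s ⊆ E` (blue = `E \\ s`); `openEdgeCluster ω v` is the edge cluster of `v` in the configuration `ω` (BHK's `C_v`), `openGraph ω` the open graph.
For a sink set `T ⊆ V` the RED SINK CLUSTER is `λ(s) = ⋃_{t∈T} C_t(s)` and the BLUE one `λ̄(s) = ⋃_{t∈T} C_t(E \\ s)`.  The RAA ORDER of FINDING-RAA-g20 is
  `s ⪯ s′ :⟺ λ(s′) ⊆ λ(s) ∧ λ̄(s) ⊆ λ̄(s′) ∧ ∀ v ∉ T: ρ̃_v(s) ≤ ρ̃_v(s′) ∧ β̃_v(s) ≥ β̃_v(s′)`,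
where `ρ̃_v(s)` is the red cluster of `v`, KILLED (= bottom `⊥`) when `v` is red-joined to `T`, and `β̃_v` the blue analogue; `x ≤ y` with `⊥` least
(so 'killed ≤ anything', 'alive ≤ alive′ iff ⊆', 'alive ≤ killed' never).
* `Antithetic.raaLE_iff_explicit` — **THEOREM (explicit form)**:  `s ⪯ s′ ⟺ λ(s′) ⊆ λ(s) ∧ λ̄(s) ⊆ λ̄(s′) ∧ ∀ e ∈ s \\ s′, e ∈ λ(s) ∩ λ̄(s′)`
  — the killed-cluster conditions at ALL non-sink vertices are equivalent to "an edge turns red → blue only inside the sink clusters".  Both sides are written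
  out in full (no new definitions).  Lemmas: `Antithetic.reachable_of_cluster_subset` (a cluster all of whose edges are open in `ω′` stays joined in `ω′`),
  `Antithetic.openEdgeCluster_mono_of_subset`, `Antithetic.mem_openEdgeCluster_of_adj_reachable`.
CONJECTURE RAA (g20) thus reads: the poset `(𝒫(E), ⪯)` so described is antipodal-Kleitman for the complement `s ↦ E \\ s`.  The modelling dictionaries of
the programme (PROOF-RL-g43 P1, FINDING-TREEBLOCK-g25 §1) are one-line corollaries of the explicit form (memo §0′).
-/

namespace Summit.CriticalPhenomena.PercolationContinuityZ3.Theorems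

namespace Antithetic

open Literature.Probability.Percolation

variable {V : Type*}

/-- An open non-loop edge at a vertex joined to `v` lies in the edge cluster of `v`. [folklore] -/
theorem mem_openEdgeCluster_of_adj_reachable (ω : Set (Sym2 V)) (v x y : V)
    (hx : (openGraph ω).Reachable v x) (hxy : (openGraph ω).Adj x y) : s(x, y) ∈ openEdgeCluster ω v := by
  rw [mem_openEdgeCluster_iff]
  have hadj := (openGraph_adj ω x y).1 hxy
  refine ⟨hadj.1, by rw [Sym2.mk_isDiag_iff]; exact hadj.2, ?_⟩
  intro z hz
  rcases Sym2.mem_iff.1 hz with rfl | rfl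
  · exact hx
  · exact hx.trans hxy.reachable

/-- Every edge of an open walk from `v` lies in the edge cluster of `v`. [folklore] -/
theorem walk_edges_subset_openEdgeCluster (ω : Set (Sym2 V)) {v a : V} (p : (openGraph ω).Walk v a) :
    ∀ e ∈ p.edges, e ∈ openEdgeCluster ω v := by
  induction p with
  | nil => intro e he; simp at he
  | @cons u w x hadj q ih =>
      intro e he
      rw [SimpleGraph.Walk.edges_cons, List.mem_cons] at he
      rcases he with rfl | he
      · -- need: u reachable from the start v; here the walk starts at u itself after induction generalisation — handle via a reachability argument
        exact mem_openEdgeCluster_of_adj_reachable ω u u w SimpleGraph.Reachable.rfl hadj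
      · have h := ih e he
        -- transport from the cluster of w to the cluster of u along the edge u ~ w
        rw [mem_openEdgeCluster_iff] at h ⊢
        exact ⟨h.1, h.2.1, fun z hz => (hadj.reachable).trans (h.2.2 z hz)⟩

/-- If every edge of the cluster of `v` in `ω` is open in `ω′`, then whatever is joined to `v` in `ω` is joined to `v` in `ω′`. [this work] -/
theorem reachable_of_cluster_subset (ω ω' : Set (Sym2 V)) (v x : V) (hsub : openEdgeCluster ω v ⊆ ω')
    (hx : (openGraph ω).Reachable v x) : (openGraph ω').Reachable v x := by
  obtain ⟨p⟩ := hx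
  have hp : ∀ e, e ∈ p.edges → e ∈ (openGraph ω').edgeSet := by
    intro e he
    have hC := walk_edges_subset_openEdgeCluster ω p e he
    have hω' : e ∈ ω' := hsub hC
    have hnd : ¬ e.IsDiag := ((mem_openEdgeCluster_iff ω v e).1 hC).2.1
    show e ∈ (SimpleGraph.fromEdgeSet ω').edgeSet
    rw [SimpleGraph.edgeSet_fromEdgeSet]
    exact ⟨hω', by rwa [Sym2.mem_diagSet]⟩
  exact ⟨p.transfer (openGraph ω') hp⟩

/-- If every edge of the cluster of `v` in `ω` is open in `ω′`, the cluster of `v` in `ω` is contained in its cluster in `ω′`. [this work] -/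
theorem openEdgeCluster_mono_of_subset (ω ω' : Set (Sym2 V)) (v : V) (hsub : openEdgeCluster ω v ⊆ ω') :
    openEdgeCluster ω v ⊆ openEdgeCluster ω' v := by
  intro e he
  have h := (mem_openEdgeCluster_iff ω v e).1 he
  rw [mem_openEdgeCluster_iff]
  exact ⟨hsub he, h.2.1, fun z hz => reachable_of_cluster_subset ω ω' v z hsub (h.2.2 z hz)⟩

/-- **THE EXPLICIT FORM OF THE RAA ORDER** (FINDING-MULTISINK-g44 §0′).  For a loop-free edge set `E`, a sink set `T`, a red set `s ⊆ E` and any red set `s'`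
(blue sets `E \\ s`, `E \\ s'`), the RAA order of FINDING-RAA-g20 §1 — red sink cluster shrinks, blue sink cluster grows, and for every non-sink `v`
the killed red cluster increases and the killed blue cluster decreases (killed = `v` joined to `T` in that colour, counted as a bottom element) — holds
iff the two sink-cluster conditions hold and every edge that is red in `s` and blue in `s'` lies in the red sink cluster of `s` and in the blue sink
cluster of `s'`. [this work] -/
theorem raaLE_iff_explicit (T : Set V) (E s s' : Set (Sym2 V)) (hE : ∀ e ∈ E, ¬ e.IsDiag) (hs : s ⊆ E) :
    ( (∀ e, (∃ t ∈ T, e ∈ openEdgeCluster s' t) → (∃ t ∈ T, e ∈ openEdgeCluster s t)) ∧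
      (∀ e, (∃ t ∈ T, e ∈ openEdgeCluster (E \ s) t) → (∃ t ∈ T, e ∈ openEdgeCluster (E \ s') t)) ∧
      (∀ v ∉ T, (∃ t ∈ T, (openGraph s).Reachable v t) ∨
        ((¬ ∃ t ∈ T, (openGraph s').Reachable v t) ∧ openEdgeCluster s v ⊆ openEdgeCluster s' v)) ∧
      (∀ v ∉ T, (∃ t ∈ T, (openGraph (E \ s')).Reachable v t) ∨
        ((¬ ∃ t ∈ T, (openGraph (E \ s)).Reachable v t) ∧ openEdgeCluster (E \ s') v ⊆ openEdgeCluster (E \ s) v)) )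
    ↔
    ( (∀ e, (∃ t ∈ T, e ∈ openEdgeCluster s' t) → (∃ t ∈ T, e ∈ openEdgeCluster s t)) ∧
      (∀ e, (∃ t ∈ T, e ∈ openEdgeCluster (E \ s) t) → (∃ t ∈ T, e ∈ openEdgeCluster (E \ s') t)) ∧
      (∀ e ∈ s \ s', (∃ t ∈ T, e ∈ openEdgeCluster s t) ∧ (∃ t ∈ T, e ∈ openEdgeCluster (E \ s') t)) ) := by
  classical
  -- two elementary facts: an open edge at a vertex joined to T is in the sink cluster; an edge of the sink cluster joins its endpoints to T
  have joinedEdge : ∀ (ω : Set (Sym2 V)) (x y : V), s(x, y) ∈ ω → x ≠ y → (∃ t ∈ T, (openGraph ω).Reachable x t) →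
      ∃ t ∈ T, s(x, y) ∈ openEdgeCluster ω t := by
    intro ω x y hxy hne ⟨t, ht, hxt⟩
    refine ⟨t, ht, ?_⟩
    have hadj : (openGraph ω).Adj x y := (openGraph_adj ω x y).2 ⟨hxy, hne⟩
    exact mem_openEdgeCluster_of_adj_reachable ω t x y hxt.symm hadj
  have edgeJoined : ∀ (ω : Set (Sym2 V)) (x y : V), (∃ t ∈ T, s(x, y) ∈ openEdgeCluster ω t) →
      ∃ t ∈ T, (openGraph ω).Reachable x t := by
    rintro ω x y ⟨t, ht, h⟩
    exact ⟨t, ht, (((mem_openEdgeCluster_iff ω t _).1 h).2.2 x (Sym2.mem_mk_left x y)).symm⟩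
  constructor
  · -- (⟹)
    rintro ⟨h1, h2, h3, h4⟩
    refine ⟨h1, h2, ?_⟩
    intro e he
    obtain ⟨heS, heS'⟩ := he
    have hnd : ¬ e.IsDiag := hE e (hs heS)
    induction e using Sym2.ind with
    | h x y =>
      have hne : x ≠ y := by rwa [Sym2.mk_isDiag_iff] at hnd
      constructor
      · -- e ∈ λ(s): otherwise x is red-alive in s with e in its cluster, forcing e red in s'
        by_contra hnot
        have hxT : x ∉ T := by
          intro hxT
          exact hnot ⟨x, hxT, mem_openEdgeCluster_of_adj_reachable s x x y SimpleGraph.Reachable.rfl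
            ((openGraph_adj s x y).2 ⟨heS, hne⟩)⟩
        have hxnot : ¬ ∃ t ∈ T, (openGraph s).Reachable x t := fun hj => hnot (joinedEdge s x y heS hne hj)
        rcases h3 x hxT with hj | ⟨-, hsub⟩
        · exact hxnot hj
        · have hex : s(x, y) ∈ openEdgeCluster s x :=
            mem_openEdgeCluster_of_adj_reachable s x x y SimpleGraph.Reachable.rfl ((openGraph_adj s x y).2 ⟨heS, hne⟩)
          exact heS' (openEdgeCluster_subset s' x (hsub hex))
      · -- e ∈ λ̄(s'): otherwise x is blue-alive in s' with e in its cluster, forcing e blue in s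
        by_contra hnot
        have heB' : s(x, y) ∈ E \ s' := ⟨hs heS, heS'⟩
        have hxT : x ∉ T := by
          intro hxT
          exact hnot ⟨x, hxT, mem_openEdgeCluster_of_adj_reachable (E \ s') x x y SimpleGraph.Reachable.rfl
            ((openGraph_adj (E \ s') x y).2 ⟨heB', hne⟩)⟩
        have hxnot : ¬ ∃ t ∈ T, (openGraph (E \ s')).Reachable x t := fun hj => hnot (joinedEdge (E \ s') x y heB' hne hj)
        rcases h4 x hxT with hj | ⟨-, hsub⟩
        · exact hxnot hj
        · have hex : s(x, y) ∈ openEdgeCluster (E \ s') x :=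
            mem_openEdgeCluster_of_adj_reachable (E \ s') x x y SimpleGraph.Reachable.rfl ((openGraph_adj (E \ s') x y).2 ⟨heB', hne⟩)
          exact (openEdgeCluster_subset (E \ s) x (hsub hex)).2 heS
  · -- (⟸)
    rintro ⟨h1, h2, h3⟩
    refine ⟨h1, h2, ?_, ?_⟩
    · -- red killed clusters
      intro v hvT
      by_cases hj : ∃ t ∈ T, (openGraph s).Reachable v t
      · exact Or.inl hj
      · right
        -- every edge of the (alive) red cluster of v in s is red in s'
        have hsub : openEdgeCluster s v ⊆ s' := by
          intro e he
          have hm := (mem_openEdgeCluster_iff s v e).1 he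
          by_contra hes'
          have hlam := (h3 e ⟨hm.1, hes'⟩).1
          -- e ∈ λ(s) joins an endpoint of e, hence v, to T in s
          induction e using Sym2.ind with
          | h x y =>
            obtain ⟨t, ht, hxt⟩ := edgeJoined s x y hlam
            exact hj ⟨t, ht, (hm.2.2 x (Sym2.mem_mk_left x y)).trans hxt⟩
        refine ⟨?_, openEdgeCluster_mono_of_subset s s' v hsub⟩
        -- v is not red-joined to T in s': a joining walk would start with... use: if v ~ t in s' then t ∈ openCluster; take the first edge? Simpler:
        -- if v is joined to t in s', then every... we argue via clusters: v = t impossible (v ∉ T); else the walk has a first edge s(v,w) ∈ s' with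
        -- w joined to t; that edge lies in λ(s') ⊆ λ(s) ⊆ s, so it is red in s and in λ(s), which joins v to T in s — contradiction.
        rintro ⟨t, ht, hvt⟩
        obtain ⟨p⟩ := hvt
        cases p with
        | nil => exact hvT ht
        | @cons _ w _ hadj q =>
            have hvw : s(v, w) ∈ s' := ((openGraph_adj s' v w).1 hadj).1
            have hne : v ≠ w := ((openGraph_adj s' v w).1 hadj).2
            have hlamp : ∃ t ∈ T, s(v, w) ∈ openEdgeCluster s' t := by
              refine ⟨t, ht, ?_⟩
              have hwt : (openGraph s').Reachable t w := (q.reachable).symm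
              have := mem_openEdgeCluster_of_adj_reachable s' t w v hwt hadj.symm
              rwa [Sym2.eq_swap] at this
            have hlam := h1 _ hlamp
            obtain ⟨t', ht', hvt'⟩ := edgeJoined s v w hlam
            exact hj ⟨t', ht', hvt'⟩
    · -- blue killed clusters (mirror image, with s and s' exchanged and blue configurations)
      intro v hvT
      by_cases hj : ∃ t ∈ T, (openGraph (E \ s')).Reachable v t
      · exact Or.inl hj
      · right
        have hsub : openEdgeCluster (E \ s') v ⊆ E \ s := by
          intro e he
          have hm := (mem_openEdgeCluster_iff (E \ s') v e).1 he
          refine ⟨hm.1.1, fun hes => ?_⟩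
          have hlam := (h3 e ⟨hes, hm.1.2⟩).2
          induction e using Sym2.ind with
          | h x y =>
            obtain ⟨t, ht, hxt⟩ := edgeJoined (E \ s') x y hlam
            exact hj ⟨t, ht, (hm.2.2 x (Sym2.mem_mk_left x y)).trans hxt⟩
        refine ⟨?_, openEdgeCluster_mono_of_subset (E \ s') (E \ s) v hsub⟩
        rintro ⟨t, ht, hvt⟩
        obtain ⟨p⟩ := hvt
        cases p with
        | nil => exact hvT ht
        | @cons _ w _ hadj q =>
            have hvw : s(v, w) ∈ E \ s := ((openGraph_adj (E \ s) v w).1 hadj).1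
            have hlam0 : ∃ t ∈ T, s(v, w) ∈ openEdgeCluster (E \ s) t := by
              refine ⟨t, ht, ?_⟩
              have hwt : (openGraph (E \ s)).Reachable t w := (q.reachable).symm
              have := mem_openEdgeCluster_of_adj_reachable (E \ s) t w v hwt hadj.symm
              rwa [Sym2.eq_swap] at this
            have hlam := h2 _ hlam0
            obtain ⟨t', ht', hvt'⟩ := edgeJoined (E \ s') v w hlam
            exact hj ⟨t', ht', hvt'⟩

end Antithetic

end Summit.CriticalPhenomena.PercolationContinuityZ3.Theorems
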